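import Literature.Topology.FourManifolds.TrisectionsCornerModel
import Literature.Topology.FourManifolds.EmbeddingBoundaryInvariance
import HarnessLib

/-!
# Local structure of a Gay–Kirby trisection along the central surface

Topic `Literature/Topology/FourManifolds`; infrastructure for the fact seat
`provefact-Literature.Topology.FourManifolds.exists-14560f9fc8` (named fact (c′)
`Literature.Topology.FourManifolds.exists_stabilized_gkTrisection`: Gay–Kirby stabilisation of a
trisection with corners, `TrisectionFunctorGK.lean`), whose geometric half modifies a given
trisection near points of the central surface `F = S 0 ∩ S 1 ∩ S 2` (Gay–Kirby 2016, Def. 8).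
Everything in this file is **proved**; no definitions, no named facts.

The corrected predicate `Literature.Topology.FourManifolds.IsGKTrisection` (`Trisections.lean`)
presents each sector `S i` as the image of a topological embedding `e : W → X` of a compact
`4`-manifold with boundary which is a `C^∞` immersion at the points not mapped to `F` and has a
*corner chart* (`Literature.Topology.FourManifolds.IsCornerAt`: `ψ ∘ e ∘ φ⁻¹ = A ∘ cornerUnbend`)
at the points mapped to `F`.  This file extracts from these clauses the local picture of
Gay–Kirby's Fig. 1 ("`Xᵢ` is locally `F × (sector)`") as statements about subsets of `X`:

* `not_differentiableWithinAt_sqrt_Ici_zero`, `not_differentiableWithinAt_cornerUnbend`,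
  `not_contDiffWithinAt_of_eqOn_cornerUnbend` — the angle-straightening map `cornerUnbend`
  (principal square root) is **not differentiable within the half-space at the points of the
  corner stratum** `{x₀ = x₁ = 0}` (along the boundary ray `{x₀ = 0, x₁ = t ≥ 0}` its second
  coordinate is `√t`).  This is what tells corner points from immersion points.
* `apply_eq_cornerUnbend_of_eqOn`, `mem_image_source_iff_of_eqOn`,
  `exists_linearChart_of_isCornerAt` — **local linearity of a sector**: for a topological
  embedding `e : W → X` with a corner chart `(φ, ψ, A)` at `w` one has the pointwise identity
  `ψ (e w') = A (cornerUnbend (φ w'))` on `φ.source`,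
  `e(φ.source) = {x ∈ ψ.source | A⁻¹(ψ x) ∈ Q, cornerFold (A⁻¹ψ x) ∈ (𝓡∂ 4)⁻¹ φ.target}`
  (`Q = cornerQuadrant`), and an open `O ∋ e w` inside `ψ.source` with
  `range e ∩ O = e(φ.source) = {x ∈ O | A⁻¹(ψ x) ∈ Q}`.
* `not_stratum_of_isImmersionAt`, `stratum_of_isCornerAt`,
  `exists_linearChart_centralSurface_of_isCornerAt` — if moreover `e` is a `C^∞` immersion at
  every point not mapped into a set `F ⊆ range e` and has a corner chart at every point mapped
  into `F` (clause (ii)), then **`F ∩ O = {x ∈ O | A⁻¹(ψ x) ∈ Q, (A⁻¹ψ x)₀ = (A⁻¹ψ x)₁ = 0}`**: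
  the central surface is exactly the corner stratum (both inclusions by the
  non-differentiability of `cornerUnbend` at the stratum: an immersion point cannot sit on the
  stratum, and a corner point read through a second corner chart — changing charts by the `C^∞`
  coordinate changes of the two maximal atlases — cannot be off the stratum of the first).
* `IsGKTrisection.exists_linearChart` — for a Gay–Kirby trisection and `x ∈ F`, the sector
  `S i` is, in a smooth chart of `X` at `x` (`ψ x = 0`), the linear `2`-sector `A(Q)`, `F` is
  its stratum, and a point of the chart domain lies in one of the *other* two sectors iff it is
  not in the open sector `A(Q°)` (invariance of the boundary, `not_mem_nhds_of_isBoundaryPoint`;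
  `cornerQuadrant_not_mem_nhds`; the covering clause (i); closedness of the sectors).
* `mem_closure_interior_halfSpace` (interior points are dense in a manifold with boundary),
  `IsGKTrisection.not_inter_inter_subset_iInter` (near a point of `F`, `S i ∩ S l ⊄ F`: clause
  (iii)), and `IsGKTrisection.exists_linearChart_faces` — **the two open faces `A({q₀ = 0 < q₁})`,
  `A({q₁ = 0 < q₀})` of `S i` lie one in each of the two other sectors** (each face piece over a
  round chart ball is connected and covered by the two other closed sectors, disjointly off
  `F`; both in the same sector would force `S i ∩ S l ⊆ F` near `x`).  Together: near `x ∈ F`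
  the three sectors are `S i = A(Q)`, and `S (i+1)`, `S (i+2)` fill the closed complement,
  meeting `S i` along one face each — Gay–Kirby's Fig. 1 over the predicate.

## References

* D. Gay, R. Kirby, *Trisecting 4-manifolds*, Geom. Topol. 20 (2016) 3097–3132
  (arXiv:1205.1565): Def. 1 and Fig. 1 (p. 3098: the sectors near `F`), Def. 8 (stabilisation
  modifies the sectors near arcs ending on `F`). [GayKirby2016]
* A. Douady, *Variétés à bord anguleux et voisinages tubulaires*, Séminaire H. Cartan 14
  (1961/62), exp. 1, §1 and §4 (sectors of index `2`, the corner stratum). [Douady1961]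
* M. W. Hirsch, *Differential Topology* (1976), §1.4 (invariance of boundary and corners under
  diffeomorphisms). [Hirsch1976]
* A. Douady, L. Hérault, *Arrondissement des variétés à coins*, appendix to A. Borel,
  J.-P. Serre, Comment. Math. Helv. 48 (1973) 436–491 (the square-root straightening).
  [DouadyHerault1973]
* A. Hatcher, *Algebraic Topology*, CUP (2002), Thm. 2B.3 and the remark following it
  (invariance of the boundary). [HatcherAT2002]
-/

open scoped Manifold ContDiff Topology
open Set Function Filter

noncomputable section

namespace Literature.Topology.FourManifolds

universe u

/-! ### The square root and the angle-straightening map are not differentiable at the corner -/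

section Sqrt

/-- The real square root is not differentiable at `0` from the right: if it had a derivative `L`
within `[0, ∞)` at `0`, then `t = (√t)²` would have derivative `2·√0·L = 0` there. [folklore] -/
theorem not_differentiableWithinAt_sqrt_Ici_zero :
    ¬ DifferentiableWithinAt ℝ Real.sqrt (Ici (0:ℝ)) 0 := by
  intro h
  have hd : HasDerivWithinAt Real.sqrt (derivWithin Real.sqrt (Ici (0:ℝ)) 0) (Ici 0) 0 :=
    h.hasDerivWithinAt
  -- `(√t)²` has derivative `L * √0 + √0 * L = 0` within `[0, ∞)` at `0`
  have hsq : HasDerivWithinAt (fun t => Real.sqrt t * Real.sqrt t) 0 (Ici 0) 0 := by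
    have h2 := hd.mul hd
    simp only [Real.sqrt_zero, zero_mul, mul_zero, add_zero] at h2
    exact h2
  -- but on `[0, ∞)` it is the identity, with derivative `1`
  have hid : HasDerivWithinAt (fun t => Real.sqrt t * Real.sqrt t) 1 (Ici (0:ℝ)) 0 := by
    refine (hasDerivWithinAt_id (0:ℝ) _).congr (fun t ht => ?_) (by simp)
    exact Real.mul_self_sqrt ht
  have huniq : UniqueDiffWithinAt ℝ (Ici (0:ℝ)) 0 :=
    uniqueDiffWithinAt_convex (convex_Ici 0) (by simp) (by simp)
  have := huniq.eq_deriv _ hid hsq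
  exact one_ne_zero this

end Sqrt

section Stratum

/-- **`cornerUnbend` is not differentiable within the half-space `{x₀ ≥ 0}` at a point of the
corner stratum `{x₀ = x₁ = 0}`.**  Along the ray `t ↦ s + t·e₁` (`t ≥ 0`), which stays in the
boundary plane of the half-space, the second coordinate of `cornerUnbend` is `√t`
(`cornerUnbend_of_apply_zero_eq_zero_of_nonneg`). [cite: DouadyHerault1973, Appendice] -/
theorem not_differentiableWithinAt_cornerUnbend {s : (EuclideanSpace ℝ (Fin 4))} (h0 : s 0 = 0)
    (h1 : s 1 = 0) :
    ¬ DifferentiableWithinAt ℝ cornerUnbend {x : (EuclideanSpace ℝ (Fin 4)) | 0 ≤ x 0} s := by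
  intro h
  -- the ray `γ t = s + t • e₁`
  let γ : ℝ → (EuclideanSpace ℝ (Fin 4)) := fun t => s + t • EuclideanSpace.single (1 : Fin 4) (1:ℝ)
  have hγ0 : γ 0 = s := by simp [γ]
  have hγd : DifferentiableWithinAt ℝ γ (Ici 0) 0 := by
    apply DifferentiableAt.differentiableWithinAt
    simp only [γ]
    fun_prop
  have hγmaps : MapsTo γ (Ici (0:ℝ)) {x : (EuclideanSpace ℝ (Fin 4)) | 0 ≤ x 0} := by
    intro t _
    simp [γ, h0]
  have hcoord : Differentiable ℝ fun x : (EuclideanSpace ℝ (Fin 4)) => x 1 :=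
    (EuclideanSpace.proj (1 : Fin 4) (𝕜 := ℝ)).differentiable
  have hcomp : DifferentiableWithinAt ℝ (fun t => cornerUnbend (γ t) 1) (Ici 0) 0 := by
    have h' :
        DifferentiableWithinAt ℝ cornerUnbend {x : (EuclideanSpace ℝ (Fin 4)) | 0 ≤ x 0} (γ 0) := by
      rwa [hγ0]
    exact (hcoord _).comp_differentiableWithinAt _ (h'.comp 0 hγd hγmaps)
  -- on `[0, ∞)` this function is `√t`
  have heq : EqOn (fun t => cornerUnbend (γ t) 1) Real.sqrt (Ici (0:ℝ)) := by
    intro t ht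
    have hγt0 : γ t 0 = 0 := by simp [γ, h0]
    have hγt1 : γ t 1 = t := by simp [γ, h1]
    have ht' : 0 ≤ γ t 1 := by rw [hγt1]; exact ht
    show cornerUnbend (γ t) 1 = Real.sqrt t
    rw [cornerUnbend_of_apply_zero_eq_zero_of_nonneg hγt0 ht', hγt1]
    simp
  exact not_differentiableWithinAt_sqrt_Ici_zero (hcomp.congr (fun t ht => (heq ht).symm)
    (by simpa using (heq (self_mem_Ici (a := (0:ℝ)))).symm))

/-- Hence a map which agrees with `A ∘ cornerUnbend` near a stratum point within the half-space,
for a continuous linear automorphism `A`, is not `C^n` (`n ≠ 0`) within the half-space there.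
[cite: DouadyHerault1973, Appendice] -/
theorem not_contDiffWithinAt_of_eqOn_cornerUnbend {n : WithTop ℕ∞} (hn : n ≠ 0)
    {T : (EuclideanSpace ℝ (Fin 4)) → (EuclideanSpace ℝ (Fin 4))}
    (A : (EuclideanSpace ℝ (Fin 4)) ≃L[ℝ] (EuclideanSpace ℝ (Fin 4)))
    {U : Set (EuclideanSpace ℝ (Fin 4))} {s : (EuclideanSpace ℝ (Fin 4))}
    (hU : U ∈ 𝓝[{x : (EuclideanSpace ℝ (Fin 4)) | 0 ≤ x 0}] s) (hs : 0 ≤ s 0)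
    (h0 : s 0 = 0) (h1 : s 1 = 0)
    (heq : EqOn T (A ∘ cornerUnbend) U) :
    ¬ ContDiffWithinAt ℝ n T {x : (EuclideanSpace ℝ (Fin 4)) | 0 ≤ x 0} s := by
  intro hT
  apply not_differentiableWithinAt_cornerUnbend h0 h1
  have hT' : ContDiffWithinAt ℝ n (A.symm ∘ T) {x : (EuclideanSpace ℝ (Fin 4)) | 0 ≤ x 0} s :=
    A.symm.contDiff.comp_contDiffWithinAt hT
  have hd : DifferentiableWithinAt ℝ (A.symm ∘ T) {x : (EuclideanSpace ℝ (Fin 4)) | 0 ≤ x 0} s :=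
    hT'.differentiableWithinAt hn
  refine hd.congr_of_eventuallyEq ?_ ?_
  · filter_upwards [hU] with x hx
    simp [heq hx]
  · have hsU : s ∈ U := mem_of_mem_nhdsWithin hs hU
    simp [heq hsU]

end Stratum

/-! ### A sector is a linear `2`-sector near a corner point -/

section CornerChart

variable {X : Type u} [TopologicalSpace X] {W : Type*} [TopologicalSpace W]
  {e : W → X} {φ : OpenPartialHomeomorph W (EuclideanHalfSpace 4)}
  {ψ : OpenPartialHomeomorph X (EuclideanSpace ℝ (Fin 4))}
  {A : (EuclideanSpace ℝ (Fin 4)) ≃L[ℝ] (EuclideanSpace ℝ (Fin 4))}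

/-- The target of an extended half-space chart is the trace on the closed half-space `{x₀ ≥ 0}`
of the open set `(𝓡∂ 4)⁻¹(φ.target)`. [folklore] -/
theorem extend_target_eq_inter_halfSpace (φ : OpenPartialHomeomorph W (EuclideanHalfSpace 4)) :
    (φ.extend (𝓡∂ 4)).target =
      (𝓡∂ 4).symm ⁻¹' φ.target ∩ {x : (EuclideanSpace ℝ (Fin 4)) | 0 ≤ x 0} := by
  rw [OpenPartialHomeomorph.extend_target, range_modelWithCornersEuclideanHalfSpace]

/-- The open set `(𝓡∂ 4)⁻¹(φ.target) ⊆ ℝ⁴`. [folklore] -/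
theorem isOpen_preimage_symm_target (φ : OpenPartialHomeomorph W (EuclideanHalfSpace 4)) :
    IsOpen ((𝓡∂ 4).symm ⁻¹' φ.target : Set (EuclideanSpace ℝ (Fin 4))) :=
  φ.open_target.preimage (𝓡∂ 4).continuous_symm

/-- Points of the extended target have non-negative first coordinate. [folklore] -/
theorem apply_zero_nonneg_of_mem_extend_target {x : (EuclideanSpace ℝ (Fin 4))}
    (hx : x ∈ (φ.extend (𝓡∂ 4)).target) :
    0 ≤ x 0 := by
  rw [extend_target_eq_inter_halfSpace] at hx
  exact hx.2

/-- The extended chart value of a point has non-negative first coordinate. [folklore] -/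
theorem extend_apply_zero_nonneg (φ : OpenPartialHomeomorph W (EuclideanHalfSpace 4)) (w : W) :
    0 ≤ φ.extend (𝓡∂ 4) w 0 := by
  have : φ.extend (𝓡∂ 4) w ∈ range (𝓡∂ 4) := by
    rw [OpenPartialHomeomorph.extend_coe]
    exact mem_range_self _
  rw [range_modelWithCornersEuclideanHalfSpace] at this
  exact this

/-- A chart value with vanishing boundary coordinate extends to `0 ∈ ℝ⁴`. [folklore] -/
theorem extend_apply_eq_zero {w : W} (hw0 : (φ w).val = 0) : φ.extend (𝓡∂ 4) w = 0 := by
  rw [OpenPartialHomeomorph.extend_coe, comp_apply]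
  exact hw0

/-- The target of an extended half-space chart is a neighbourhood of each of its points within
the closed half-space `{x₀ ≥ 0}`. [folklore] -/
theorem extend_target_mem_nhdsWithin_halfSpace {w : W} (hw : w ∈ φ.source) :
    (φ.extend (𝓡∂ 4)).target ∈ 𝓝[{x : (EuclideanSpace ℝ (Fin 4)) | 0 ≤ x 0}] φ.extend (𝓡∂ 4) w := by
  rw [← range_modelWithCornersEuclideanHalfSpace 4]
  exact φ.extend_target_mem_nhdsWithin (I := 𝓡∂ 4) hw

/-- For the boundaryless model `𝓡 4` the extended chart is the chart. [folklore] -/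
theorem extend_self_apply (ψ : OpenPartialHomeomorph X (EuclideanSpace ℝ (Fin 4))) (x : X) :
    ψ.extend (𝓡 4) x = ψ x := rfl

/-- For the boundaryless model `𝓡 4` the inverse extended chart is the inverse chart. [folklore] -/
theorem extend_self_symm_apply (ψ : OpenPartialHomeomorph X (EuclideanSpace ℝ (Fin 4)))
    (y : (EuclideanSpace ℝ (Fin 4))) :
    (ψ.extend (𝓡 4)).symm y = ψ.symm y := rfl

/-- **The corner-chart identity.**  In a corner chart `(φ, ψ, A)` of `e`
(`ψ ∘ e ∘ φ⁻¹ = A ∘ cornerUnbend` on the chart target), for every `w'` in the chart domain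
`ψ (e w') = A (cornerUnbend (φ w'))`. [cite: Douady1961, §1 and §4] -/
theorem apply_eq_cornerUnbend_of_eqOn
    (heq : EqOn (ψ ∘ e ∘ (φ.extend (𝓡∂ 4)).symm) (A ∘ cornerUnbend) (φ.extend (𝓡∂ 4)).target)
    {w' : W} (hw' : w' ∈ φ.source) :
    ψ (e w') = A (cornerUnbend (φ.extend (𝓡∂ 4) w')) := by
  have hs : φ.extend (𝓡∂ 4) w' ∈ (φ.extend (𝓡∂ 4)).target :=
    (φ.extend (𝓡∂ 4)).map_source (by rwa [OpenPartialHomeomorph.extend_source])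
  have h := heq hs
  simp only [comp_apply] at h
  rwa [(φ.extend (𝓡∂ 4)).left_inv (by rwa [OpenPartialHomeomorph.extend_source])] at h

/-- In a corner chart, `A⁻¹ (ψ (e w'))` lies in the model quadrant and folds back to `φ w'`.
[cite: Douady1961, §1 and §4] -/
theorem symm_apply_mem_cornerQuadrant_of_eqOn
    (heq : EqOn (ψ ∘ e ∘ (φ.extend (𝓡∂ 4)).symm) (A ∘ cornerUnbend) (φ.extend (𝓡∂ 4)).target)
    {w' : W} (hw' : w' ∈ φ.source) :
    A.symm (ψ (e w')) ∈ cornerQuadrant ∧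
      cornerFold (A.symm (ψ (e w'))) = φ.extend (𝓡∂ 4) w' := by
  rw [apply_eq_cornerUnbend_of_eqOn heq hw', ContinuousLinearEquiv.symm_apply_apply]
  exact ⟨cornerUnbend_mem_cornerQuadrant _,
    cornerFold_cornerUnbend (extend_apply_zero_nonneg φ w')⟩

/-- **The image of the corner-chart domain, read in the chart of `X`.**  For a corner chart
`(φ, ψ, A)` of `e` with `e(φ.source) ⊆ ψ.source`:
`e(φ.source) = {x ∈ ψ.source | A⁻¹(ψ x) ∈ Q and cornerFold (A⁻¹(ψ x)) ∈ (𝓡∂ 4)⁻¹(φ.target)}`.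
[cite: Douady1961, §1 and §4] -/
theorem mem_image_source_iff_of_eqOn (hsrc : φ.source ⊆ e ⁻¹' ψ.source)
    (heq : EqOn (ψ ∘ e ∘ (φ.extend (𝓡∂ 4)).symm) (A ∘ cornerUnbend) (φ.extend (𝓡∂ 4)).target)
    (x : X) :
    x ∈ e '' φ.source ↔ x ∈ ψ.source ∧ A.symm (ψ x) ∈ cornerQuadrant ∧
      cornerFold (A.symm (ψ x)) ∈ ((𝓡∂ 4).symm ⁻¹' φ.target : Set (EuclideanSpace ℝ (Fin 4))) := by
  constructor
  · rintro ⟨w', hw', rfl⟩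
    obtain ⟨hQ, hfold⟩ := symm_apply_mem_cornerQuadrant_of_eqOn heq hw'
    refine ⟨hsrc hw', hQ, ?_⟩
    rw [hfold]
    have hs : φ.extend (𝓡∂ 4) w' ∈ (φ.extend (𝓡∂ 4)).target :=
      (φ.extend (𝓡∂ 4)).map_source (by rwa [OpenPartialHomeomorph.extend_source])
    rw [extend_target_eq_inter_halfSpace] at hs
    exact hs.1
  · rintro ⟨hxψ, hQ, hV⟩
    set y := A.symm (ψ x) with hy
    set s := cornerFold y with hsdef
    have hsT : s ∈ (φ.extend (𝓡∂ 4)).target := by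
      rw [extend_target_eq_inter_halfSpace]
      exact ⟨hV, cornerFold_apply_zero_nonneg hQ⟩
    refine ⟨(φ.extend (𝓡∂ 4)).symm s, ?_, ?_⟩
    · have := (φ.extend (𝓡∂ 4)).map_target hsT
      rwa [OpenPartialHomeomorph.extend_source] at this
    · have h1 : ψ (e ((φ.extend (𝓡∂ 4)).symm s)) = A (cornerUnbend s) := by
        have := heq hsT
        simpa only [comp_apply] using this
      rw [hsdef, cornerUnbend_cornerFold hQ, hy, ContinuousLinearEquiv.apply_symm_apply] at h1
      have hmem : e ((φ.extend (𝓡∂ 4)).symm s) ∈ ψ.source := by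
        apply hsrc
        have := (φ.extend (𝓡∂ 4)).map_target hsT
        rwa [OpenPartialHomeomorph.extend_source] at this
      exact ψ.injOn hmem hxψ h1

/-- The set `{x ∈ ψ.source | cornerFold (A⁻¹(ψ x)) ∈ (𝓡∂ 4)⁻¹(φ.target)}` cut out by a corner
chart is open in `X`. [folklore] -/
theorem isOpen_cornerChartDomain (φ : OpenPartialHomeomorph W (EuclideanHalfSpace 4))
    (ψ : OpenPartialHomeomorph X (EuclideanSpace ℝ (Fin 4)))
    (A : (EuclideanSpace ℝ (Fin 4)) ≃L[ℝ] (EuclideanSpace ℝ (Fin 4))) :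
    IsOpen {x : X | x ∈ ψ.source ∧
      cornerFold (A.symm (ψ x)) ∈ ((𝓡∂ 4).symm ⁻¹' φ.target : Set (EuclideanSpace ℝ (Fin 4)))} := by
  have hc : ContinuousOn (fun x => cornerFold (A.symm (ψ x))) ψ.source :=
    (continuous_cornerFold.comp A.symm.continuous).comp_continuousOn ψ.continuousOn
  exact hc.isOpen_inter_preimage ψ.open_source (isOpen_preimage_symm_target φ)

/-- **Local linearity of a sector (Gay–Kirby's Fig. 1).**  Let `e : W → X` be a topological
embedding of a `4`-manifold with boundary with a corner chart at `w`.  Then there are a chart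
`ψ` of the `C^∞` maximal atlas of `X`, a linear automorphism `A` of `ℝ⁴`, a chart `φ` of the
maximal atlas of `W` at `w` (`φ w = 0`) with `e(φ.source) ⊆ ψ.source` and the corner-chart
identity, and an open set `O ∋ e w` of `X` inside `ψ.source`, such that
`range e ∩ O = e(φ.source) = {x ∈ O | A⁻¹(ψ x) ∈ Q}`: near `e w` the image of `e` is, in the
chart `ψ`, *exactly* the linear `2`-sector `A(Q)`. [cite: GayKirby2016, Def. 1 and Fig. 1]
[cite: Douady1961, §1 and §4] -/
theorem exists_linearChart_of_isCornerAt [ChartedSpace (EuclideanSpace ℝ (Fin 4)) X]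
    [ChartedSpace (EuclideanHalfSpace 4) W]
    (he : Topology.IsEmbedding e) {w : W} (h : IsCornerAt e w) :
    ∃ (φ : OpenPartialHomeomorph W (EuclideanHalfSpace 4))
      (ψ : OpenPartialHomeomorph X (EuclideanSpace ℝ (Fin 4)))
      (A : (EuclideanSpace ℝ (Fin 4)) ≃L[ℝ] (EuclideanSpace ℝ (Fin 4))) (O : Set X),
      φ ∈ IsManifold.maximalAtlas (𝓡∂ 4) ∞ W ∧ ψ ∈ IsManifold.maximalAtlas (𝓡 4) ∞ X ∧
      w ∈ φ.source ∧ φ.source ⊆ e ⁻¹' ψ.source ∧ (φ w).val = 0 ∧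
      EqOn (ψ ∘ e ∘ (φ.extend (𝓡∂ 4)).symm) (A ∘ cornerUnbend) (φ.extend (𝓡∂ 4)).target ∧
      IsOpen O ∧ e w ∈ O ∧ O ⊆ ψ.source ∧
      range e ∩ O = e '' φ.source ∧
      (∀ x ∈ O, x ∈ range e ↔ A.symm (ψ x) ∈ cornerQuadrant) := by
  obtain ⟨φ, ψ, A, hφ, hψ, hw, hsrc, hw0, heq⟩ := h.exists_eqOn
  -- `e(φ.source)` is open in `range e`
  obtain ⟨O', hO', hO'eq⟩ := he.isOpen_iff.mp φ.open_source
  set D : Set X := {x : X | x ∈ ψ.source ∧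
      cornerFold (A.symm (ψ x)) ∈
        ((𝓡∂ 4).symm ⁻¹' φ.target : Set (EuclideanSpace ℝ (Fin 4)))} with hD
  have hDopen : IsOpen D := isOpen_cornerChartDomain φ ψ A
  have himage : e '' φ.source = range e ∩ O' := by
    rw [← hO'eq, image_preimage_eq_range_inter, inter_comm]
  have hmemD : ∀ x, x ∈ e '' φ.source ↔ x ∈ D ∧ A.symm (ψ x) ∈ cornerQuadrant := fun x => by
    rw [mem_image_source_iff_of_eqOn hsrc heq]
    simp only [hD, mem_setOf_eq]
    tauto
  refine ⟨φ, ψ, A, D ∩ O', hφ, hψ, hw, hsrc, hw0, heq, hDopen.inter hO', ?_, ?_, ?_, ?_⟩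
  · have h1 : e w ∈ e '' φ.source := mem_image_of_mem e hw
    exact ⟨((hmemD _).1 h1).1, (himage ▸ h1).2⟩
  · exact fun x hx => hx.1.1
  · apply Subset.antisymm
    · rintro x ⟨hxr, hxD, hxO'⟩
      rw [himage]
      exact ⟨hxr, hxO'⟩
    · intro x hx
      exact ⟨(himage ▸ hx).1, ((hmemD x).1 hx).1, (himage ▸ hx).2⟩
  · rintro x ⟨hxD, hxO'⟩
    constructor
    · intro hxr
      have hx : x ∈ e '' φ.source := by rw [himage]; exact ⟨hxr, hxO'⟩
      exact ((hmemD x).1 hx).2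
    · intro hQ
      have hx : x ∈ e '' φ.source := (hmemD x).2 ⟨hxD, hQ⟩
      exact (himage ▸ hx).1

end CornerChart

/-! ### The central surface is the corner stratum -/

section CentralStratum

variable {X : Type u} [TopologicalSpace X] [ChartedSpace (EuclideanSpace ℝ (Fin 4)) X]
  {W : Type*} [TopologicalSpace W] [ChartedSpace (EuclideanHalfSpace 4) W]
  {e : W → X} {F : Set X} {φ : OpenPartialHomeomorph W (EuclideanHalfSpace 4)}
  {ψ : OpenPartialHomeomorph X (EuclideanSpace ℝ (Fin 4))}
  {A : (EuclideanSpace ℝ (Fin 4)) ≃L[ℝ] (EuclideanSpace ℝ (Fin 4))}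

/-- **An immersion point is not a corner point.**  In a corner chart `(φ, ψ, A)` of `e`
(charts of the maximal `C^∞` atlases), if `e` is a `C^∞` immersion at a point `w'` of the
chart domain then `φ w'` is not on the corner stratum: `e` read in the charts is `C^∞` within
the half-space at `φ w'`, but it is `A ∘ cornerUnbend` there. [cite: Douady1961, §1 and §4] -/
theorem not_stratum_of_isImmersionAt (hφ : φ ∈ IsManifold.maximalAtlas (𝓡∂ 4) ∞ W)
    (hψ : ψ ∈ IsManifold.maximalAtlas (𝓡 4) ∞ X) (hsrc : φ.source ⊆ e ⁻¹' ψ.source)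
    (heq : EqOn (ψ ∘ e ∘ (φ.extend (𝓡∂ 4)).symm) (A ∘ cornerUnbend) (φ.extend (𝓡∂ 4)).target)
    {w' : W} (hw' : w' ∈ φ.source) (himm : Manifold.IsImmersionAt (𝓡∂ 4) (𝓡 4) ∞ e w') :
    ¬ (φ.extend (𝓡∂ 4) w' 0 = 0 ∧ φ.extend (𝓡∂ 4) w' 1 = 0) := by
  rintro ⟨h0, h1⟩
  have hsm := (contMDiffAt_iff_of_mem_maximalAtlas hφ hψ hw' (hsrc hw')).1 himm.contMDiffAt
  obtain ⟨-, hsm⟩ := hsm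
  rw [range_modelWithCornersEuclideanHalfSpace] at hsm
  refine not_contDiffWithinAt_of_eqOn_cornerUnbend (n := ∞) (by simp) A
    (extend_target_mem_nhdsWithin_halfSpace hw') (extend_apply_zero_nonneg φ w') h0 h1 ?_ hsm
  intro x hx
  have := heq hx
  simp only [comp_apply] at this ⊢
  rw [extend_self_apply, this]

/-- **A corner point is on the corner stratum of every corner chart containing it.**  In a
corner chart `(φ, ψ, A)` of `e`, if `e` has *some* corner chart at a point `w'` of the domain of
`φ`, then `φ w'` lies on the stratum `{x₀ = x₁ = 0}`: otherwise `cornerUnbend` is `C^∞` within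
the half-space at `φ w'`, so `e` read through `(φ, ψ)` is `C^∞` within the half-space near
`w'`, and then — changing charts by the `C^∞` coordinate changes of `W` and `X` — so is `e` read
through the corner chart at `w'`, which is `A' ∘ cornerUnbend` at a stratum point.
[cite: Douady1961, §1 and §4] [cite: Hirsch1976, §1.4] -/
theorem stratum_of_isCornerAt (hφ : φ ∈ IsManifold.maximalAtlas (𝓡∂ 4) ∞ W)
    (hψ : ψ ∈ IsManifold.maximalAtlas (𝓡 4) ∞ X) (hsrc : φ.source ⊆ e ⁻¹' ψ.source)
    (heq : EqOn (ψ ∘ e ∘ (φ.extend (𝓡∂ 4)).symm) (A ∘ cornerUnbend) (φ.extend (𝓡∂ 4)).target)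
    {w' : W} (hw' : w' ∈ φ.source) (hc : IsCornerAt e w') :
    φ.extend (𝓡∂ 4) w' 0 = 0 ∧ φ.extend (𝓡∂ 4) w' 1 = 0 := by
  by_contra hnot
  set s : (EuclideanSpace ℝ (Fin 4)) := φ.extend (𝓡∂ 4) w' with hsdef
  have hs0 : 0 ≤ s 0 := extend_apply_zero_nonneg φ w'
  have hne : s 0 ≠ 0 ∨ s 1 ≠ 0 := by
    by_contra h'
    push Not at h'
    exact hnot h'
  -- the second corner chart, at `w'`
  obtain ⟨φ₂, ψ₂, A₂, hφ₂, hψ₂, hw₂, hsrc₂, hw₂0, heq₂⟩ := hc.exists_eqOn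
  have hzero : φ₂.extend (𝓡∂ 4) w' = 0 := extend_apply_eq_zero hw₂0
  -- `e` read through `(φ₂, ψ₂)` is `C^∞` within the half-space at `0 = φ₂ w'`
  let H : Set (EuclideanSpace ℝ (Fin 4)) := {x : (EuclideanSpace ℝ (Fin 4)) | 0 ≤ x 0}
  let τ : (EuclideanSpace ℝ (Fin 4)) → (EuclideanSpace ℝ (Fin 4)) := (𝓡∂ 4).extendCoordChange φ₂ φ
  let G : (EuclideanSpace ℝ (Fin 4)) → (EuclideanSpace ℝ (Fin 4)) :=
    (𝓡 4).extendCoordChange ψ ψ₂ ∘ ((A ∘ cornerUnbend) ∘ τ)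
  have hτ0 : τ 0 = s := by
    show φ.extend (𝓡∂ 4) ((φ₂.extend (𝓡∂ 4)).symm 0) = s
    rw [← hzero, (φ₂.extend (𝓡∂ 4)).left_inv (by rwa [OpenPartialHomeomorph.extend_source])]
  have hτ : ContDiffWithinAt ℝ ∞ τ H 0 := by
    have := (𝓡∂ 4).contDiffWithinAt_extendCoordChange' (n := ∞) hφ₂ hφ hw₂ hw'
    rwa [range_modelWithCornersEuclideanHalfSpace, hzero] at this
  have hτmaps : MapsTo τ H H := by
    intro z _
    exact extend_apply_zero_nonneg φ _
  have hAc : ContDiffWithinAt ℝ ∞ (A ∘ cornerUnbend) H (τ 0) := by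
    rw [hτ0]
    exact A.contDiff.comp_contDiffWithinAt (contDiffWithinAt_cornerUnbend hs0 hne)
  have hinner : ContDiffWithinAt ℝ ∞ ((A ∘ cornerUnbend) ∘ τ) H 0 := hAc.comp 0 hτ hτmaps
  have hpt : ((A ∘ cornerUnbend) ∘ τ) 0 = ψ.extend (𝓡 4) (e w') := by
    show A (cornerUnbend (τ 0)) = _
    rw [hτ0, hsdef, extend_self_apply, apply_eq_cornerUnbend_of_eqOn heq hw']
  have houter : ContDiffAt ℝ ∞ ((𝓡 4).extendCoordChange ψ ψ₂) (((A ∘ cornerUnbend) ∘ τ) 0) := by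
    rw [hpt]
    have := (𝓡 4).contDiffWithinAt_extendCoordChange' (n := ∞) hψ hψ₂ (hsrc hw') (hsrc₂ hw₂)
    rwa [ModelWithCorners.range_eq_univ, contDiffWithinAt_univ] at this
  have hG : ContDiffWithinAt ℝ ∞ G H 0 := houter.comp_contDiffWithinAt 0 hinner
  -- and it agrees with `ψ₂ ∘ e ∘ φ₂⁻¹` near `0` within the half-space
  have hU₁ : (φ₂.extend (𝓡∂ 4)).target ∈ 𝓝[H] (0 : (EuclideanSpace ℝ (Fin 4))) := by
    rw [← hzero]
    exact extend_target_mem_nhdsWithin_halfSpace hw₂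
  have hU₂ : (φ₂.extend (𝓡∂ 4)).symm ⁻¹' φ.source ∈ 𝓝[H] (0 : (EuclideanSpace ℝ (Fin 4))) := by
    rw [← hzero]
    exact mem_nhdsWithin_of_mem_nhds
      (φ₂.extend_preimage_mem_nhds (I := 𝓡∂ 4) hw₂ (φ.open_source.mem_nhds hw'))
  have hGeq : ∀ z ∈ (φ₂.extend (𝓡∂ 4)).target ∩ (φ₂.extend (𝓡∂ 4)).symm ⁻¹' φ.source,
      (ψ₂ ∘ e ∘ (φ₂.extend (𝓡∂ 4)).symm) z = G z := by
    rintro z ⟨-, hzφ⟩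
    rw [mem_preimage] at hzφ
    show ψ₂ (e ((φ₂.extend (𝓡∂ 4)).symm z)) = ψ₂.extend (𝓡 4) ((ψ.extend (𝓡 4)).symm
      (A (cornerUnbend (φ.extend (𝓡∂ 4) ((φ₂.extend (𝓡∂ 4)).symm z)))))
    rw [← apply_eq_cornerUnbend_of_eqOn heq hzφ, extend_self_symm_apply, ψ.left_inv (hsrc hzφ),
      extend_self_apply]
  have hT : ContDiffWithinAt ℝ ∞ (ψ₂ ∘ e ∘ (φ₂.extend (𝓡∂ 4)).symm) H 0 := by
    refine hG.congr_of_eventuallyEq ?_ ?_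
    · filter_upwards [inter_mem hU₁ hU₂] with z hz using hGeq z hz
    · apply hGeq
      refine ⟨?_, ?_⟩
      · rw [← hzero]
        exact (φ₂.extend (𝓡∂ 4)).map_source (by rwa [OpenPartialHomeomorph.extend_source])
      · rw [mem_preimage, ← hzero,
          (φ₂.extend (𝓡∂ 4)).left_inv (by rwa [OpenPartialHomeomorph.extend_source])]
        exact hw'
  exact not_contDiffWithinAt_of_eqOn_cornerUnbend (n := ∞) (by simp) A₂ hU₁ le_rfl rfl rfl
    heq₂ hT

end CentralStratum

/-! ### Packaging: clause (ii) of `IsGKTrisection`, and the trisection -/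

section Quadrant

/-- A stratum point is fixed by `cornerUnbend` in its first two coordinates (both vanish).
[cite: DouadyHerault1973, Appendice] -/
theorem cornerUnbend_apply_eq_zero_of_stratum {s : (EuclideanSpace ℝ (Fin 4))} (h0 : s 0 = 0)
    (h1 : s 1 = 0) :
    cornerUnbend s 0 = 0 ∧ cornerUnbend s 1 = 0 := by
  rw [cornerUnbend_of_apply_zero_eq_zero_of_nonneg h0 (le_of_eq h1.symm), h1]
  simp

/-- The model quadrant is not a neighbourhood of any of its face points. [folklore] -/
theorem cornerQuadrant_not_mem_nhds {q : (EuclideanSpace ℝ (Fin 4))} (hq : q 0 = 0 ∨ q 1 = 0) :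
    cornerQuadrant ∉ 𝓝 q := by
  intro hQ
  -- push `q` slightly across the face it lies on
  obtain ⟨k, hk⟩ : ∃ k : Fin 4, (k = 0 ∨ k = 1) ∧ q k = 0 := by
    rcases hq with h | h
    · exact ⟨0, Or.inl rfl, h⟩
    · exact ⟨1, Or.inr rfl, h⟩
  let γ : ℝ → (EuclideanSpace ℝ (Fin 4)) := fun t => q - t • EuclideanSpace.single k (1:ℝ)
  have hγ : Tendsto γ (𝓝[>] 0) (𝓝 q) := by
    have hc : Continuous γ := by fun_prop
    have h0 : γ 0 = q := by simp [γ]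
    rw [← h0]
    exact (hc.tendsto 0).mono_left nhdsWithin_le_nhds
  have hev : ∀ᶠ t in 𝓝[>] (0:ℝ), γ t ∈ cornerQuadrant := hγ hQ
  obtain ⟨t, ht, htpos⟩ := (hev.and self_mem_nhdsWithin).exists
  have hγk : γ t k = -t := by simp [γ, hk.2]
  have hnonneg : 0 ≤ γ t k := by
    rcases hk.1 with rfl | rfl
    · exact ht.1
    · exact ht.2
  rw [hγk] at hnonneg
  exact absurd (mem_Ioi.mp htpos) (not_lt.mpr (neg_nonneg.mp hnonneg))

end Quadrant

section Clauses

variable {X : Type u} [TopologicalSpace X] [ChartedSpace (EuclideanSpace ℝ (Fin 4)) X]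
  {W : Type*} [TopologicalSpace W] [ChartedSpace (EuclideanHalfSpace 4) W]

/-- **Local structure of a sector along the central surface (clause (ii) of `IsGKTrisection`).**
Let `e : W → X` be a topological embedding of a `4`-manifold with boundary into a `4`-manifold,
`F ⊆ range e`, such that `e` is a `C^∞` immersion at every point not mapped into `F` and has a
corner chart at every point mapped into `F`.  Then every point `e w ∈ F` has a chart `ψ` of the
`C^∞` maximal atlas of `X` with `ψ (e w) = 0`, a linear automorphism `A` of `ℝ⁴` and an open
neighbourhood `O ⊆ ψ.source` in which
**`range e` is the linear `2`-sector `{A⁻¹ψ ∈ Q}` and `F` is its corner stratum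
`{A⁻¹ψ ∈ Q, (A⁻¹ψ)₀ = (A⁻¹ψ)₁ = 0}`** (Gay–Kirby's Fig. 1: "locally `F × sector`").
[cite: GayKirby2016, Def. 1 and Fig. 1] [cite: Douady1961, §1 and §4] -/
theorem exists_linearChart_centralSurface_of_isCornerAt {e : W → X} {F : Set X}
    (he : Topology.IsEmbedding e) (hF : F ⊆ range e)
    (himm : ∀ w, e w ∉ F → Manifold.IsImmersionAt (𝓡∂ 4) (𝓡 4) ∞ e w)
    (hcor : ∀ w, e w ∈ F → IsCornerAt e w) {w : W} (hw : e w ∈ F) :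
    ∃ (ψ : OpenPartialHomeomorph X (EuclideanSpace ℝ (Fin 4)))
      (A : (EuclideanSpace ℝ (Fin 4)) ≃L[ℝ] (EuclideanSpace ℝ (Fin 4))) (O : Set X),
      ψ ∈ IsManifold.maximalAtlas (𝓡 4) ∞ X ∧ IsOpen O ∧ e w ∈ O ∧ O ⊆ ψ.source ∧
      ψ (e w) = 0 ∧
      (∀ x ∈ O, x ∈ range e ↔ A.symm (ψ x) ∈ cornerQuadrant) ∧
      (∀ x ∈ O, x ∈ F ↔
        A.symm (ψ x) ∈ cornerQuadrant ∧ A.symm (ψ x) 0 = 0 ∧ A.symm (ψ x) 1 = 0) := by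
  obtain ⟨φ, ψ, A, O, hφ, hψ, hwφ, hsrc, hw0, heq, hO, hwO, hOψ, hrange, hmem⟩ :=
    exists_linearChart_of_isCornerAt he (hcor w hw)
  refine ⟨ψ, A, O, hψ, hO, hwO, hOψ, ?_, hmem, fun x hx => ?_⟩
  · rw [apply_eq_cornerUnbend_of_eqOn heq hwφ, extend_apply_eq_zero hw0]
    have h := cornerUnbend_of_apply_zero_eq_zero_of_nonneg (x := (0 : (EuclideanSpace ℝ (Fin 4))))
      rfl le_rfl
    rw [h]
    have : (!₂[0, √((0 : (EuclideanSpace ℝ (Fin 4))) 1), (0 : (EuclideanSpace ℝ (Fin 4))) 2,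
        (0 : (EuclideanSpace ℝ (Fin 4))) 3] : (EuclideanSpace ℝ (Fin 4))) = 0 := by
      ext i; fin_cases i <;> simp
    rw [this, map_zero]
  · constructor
    · intro hxF
      have hxr : x ∈ range e ∩ O := ⟨hF hxF, hx⟩
      rw [hrange] at hxr
      obtain ⟨w', hw', rfl⟩ := hxr
      obtain ⟨hQ, hfold⟩ := symm_apply_mem_cornerQuadrant_of_eqOn heq hw'
      have hst := stratum_of_isCornerAt hφ hψ hsrc heq hw' (hcor w' hxF)
      rw [apply_eq_cornerUnbend_of_eqOn heq hw', ContinuousLinearEquiv.symm_apply_apply]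
      exact ⟨cornerUnbend_mem_cornerQuadrant _, cornerUnbend_apply_eq_zero_of_stratum hst.1 hst.2⟩
    · rintro ⟨hQ, h0, h1⟩
      have hxr : x ∈ range e ∩ O := ⟨(hmem x hx).2 hQ, hx⟩
      rw [hrange] at hxr
      obtain ⟨w', hw', rfl⟩ := hxr
      by_contra hxF
      obtain ⟨-, hfold⟩ := symm_apply_mem_cornerQuadrant_of_eqOn heq hw'
      apply not_stratum_of_isImmersionAt hφ hψ hsrc heq hw' (himm w' hxF)
      rw [← hfold, cornerFold_eq_self h0 h1]
      exact ⟨h0, h1⟩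

end Clauses

section Trisection

variable {X : Type u} [TopologicalSpace X] [T2Space X] [ChartedSpace (EuclideanSpace ℝ (Fin 4)) X]
  {g : ℕ} {k : Fin 3 → ℕ} {S : Fin 3 → Set X}

/-- **Local structure of a Gay–Kirby trisection along the central surface.**  For a trisection
with corners `S` of `X` (`IsGKTrisection`), a sector `S i` and a point `x` of the central surface
`F = ⋂ l, S l`, there are a chart `ψ` of the `C^∞` maximal atlas of `X` with `ψ x = 0`, a linear
automorphism `A` of `ℝ⁴` and an open neighbourhood `O ⊆ ψ.source` of `x` such that, for `y ∈ O`
and `q := A⁻¹(ψ y)`: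
* `y ∈ S i ↔ q ∈ Q` — the sector is the linear `2`-sector `A(Q)` (Gay–Kirby's Fig. 1);
* `y ∈ F ↔ q ∈ Q ∧ q₀ = q₁ = 0` — the central surface is the corner stratum;
* `y` lies in one of the two *other* sectors iff `q` is not in the open sector `Q°` — the two
  faces `A({q₀ = 0 < q₁})`, `A({q₁ = 0 < q₀})` and the complement of `A(Q)` are covered by
  `S (i+1) ∪ S (i+2)`, which misses the open sector (clause (i), the clause
  `S i ∩ S j ⊆ e(∂W)` of (ii), and invariance of the boundary).
[cite: GayKirby2016, Def. 1 and Fig. 1] [cite: Douady1961, §1 and §4]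
[cite: HatcherAT2002, Thm. 2B.3 and the remark following it] -/
theorem IsGKTrisection.exists_linearChart (h : IsGKTrisection X g k S) (i : Fin 3) {x : X}
    (hx : x ∈ ⋂ l, S l) :
    ∃ (ψ : OpenPartialHomeomorph X (EuclideanSpace ℝ (Fin 4)))
      (A : (EuclideanSpace ℝ (Fin 4)) ≃L[ℝ] (EuclideanSpace ℝ (Fin 4))) (O : Set X),
      ψ ∈ IsManifold.maximalAtlas (𝓡 4) ∞ X ∧ IsOpen O ∧ x ∈ O ∧ O ⊆ ψ.source ∧ ψ x = 0 ∧
      (∀ y ∈ O, y ∈ S i ↔ A.symm (ψ y) ∈ cornerQuadrant) ∧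
      (∀ y ∈ O, y ∈ (⋂ l, S l) ↔
        A.symm (ψ y) ∈ cornerQuadrant ∧ A.symm (ψ y) 0 = 0 ∧ A.symm (ψ y) 1 = 0) ∧
      (∀ y ∈ O, (∃ j, j ≠ i ∧ y ∈ S j) ↔ ¬ (0 < A.symm (ψ y) 0 ∧ 0 < A.symm (ψ y) 1)) := by
  obtain ⟨W, _, _, e, _, _, _, -, he, hrange, himm, hcor, hbd⟩ := h.2.1 i
  have hF : (⋂ l, S l) ⊆ range e := hrange ▸ iInter_subset _ i
  have hxr : x ∈ range e := hF hx
  obtain ⟨w, rfl⟩ := hxr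
  obtain ⟨ψ, A, O, hψ, hO, hwO, hOψ, hψ0, hmem, hstr⟩ :=
    exists_linearChart_centralSurface_of_isCornerAt he hF himm hcor hx
  refine ⟨ψ, A, O, hψ, hO, hwO, hOψ, hψ0, fun y hy => hrange ▸ hmem y hy, hstr, fun y hy => ?_⟩
  -- continuity of `q = A⁻¹ ∘ ψ` on `O`
  have hc : ContinuousOn (fun y => A.symm (ψ y)) O :=
    (A.symm.continuous.comp_continuousOn ψ.continuousOn).mono hOψ
  constructor
  · rintro ⟨j, hji, hyj⟩ hopen
    -- `y` is in `S i` (open sector ⊆ sector) and in `S j`, hence the image of a boundary point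
    have hyi : y ∈ S i := by
      rw [← hrange, hmem y hy]
      exact ⟨hopen.1.le, hopen.2.le⟩
    obtain ⟨w', hw', rfl⟩ := hbd j hji ⟨hyi, hyj⟩
    apply not_mem_nhds_of_isBoundaryPoint (n := 3) he hw'
    -- but the open sector is a neighbourhood of `e w'` inside `range e`
    have hU : O ∩ (fun y => A.symm (ψ y)) ⁻¹'
        {q : (EuclideanSpace ℝ (Fin 4)) | 0 < q 0 ∧ 0 < q 1} ∈ 𝓝 (e w') := by
      refine (hc.isOpen_inter_preimage hO ?_).mem_nhds ⟨hy, hopen⟩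
      exact (isOpen_lt continuous_const (EuclideanSpace.proj (0 : Fin 4)).continuous).inter
        (isOpen_lt continuous_const (EuclideanSpace.proj (1 : Fin 4)).continuous)
    refine mem_of_superset hU ?_
    rintro z ⟨hzO, hz⟩
    exact (hmem z hzO).2 ⟨hz.1.le, hz.2.le⟩
  · intro hnot
    by_cases hyi : y ∈ S i
    · -- a face point of the sector: `S i` is not a neighbourhood of `y`, so `y` is in the
      -- closure of the complement, which is covered by the other two closed sectors
      have hQ : A.symm (ψ y) ∈ cornerQuadrant := (hmem y hy).1 (hrange ▸ hyi)
      have hface : A.symm (ψ y) 0 = 0 ∨ A.symm (ψ y) 1 = 0 := by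
        rcases hQ.1.lt_or_eq with h0 | h0
        · rcases hQ.2.lt_or_eq with h1 | h1
          · exact absurd ⟨h0, h1⟩ hnot
          · exact Or.inr h1.symm
        · exact Or.inl h0.symm
      have hSi : S i ∉ 𝓝 y := by
        intro hN
        apply cornerQuadrant_not_mem_nhds hface
        -- push the neighbourhood `S i ∩ O` forward along the homeomorphism `A⁻¹ ∘ ψ`
        have hmap : map (fun y => A.symm (ψ y)) (𝓝 y) = 𝓝 (A.symm (ψ y)) := by
          have h1 : map ψ (𝓝 y) = 𝓝 (ψ y) := ψ.map_nhds_eq (hOψ hy)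
          have h2 : map A.symm (𝓝 (ψ y)) = 𝓝 (A.symm (ψ y)) :=
            A.symm.toHomeomorph.map_nhds_eq (ψ y)
          have : (fun y => A.symm (ψ y)) = A.symm ∘ ψ := rfl
          rw [this, ← Filter.map_map, h1]
          exact h2
        rw [← hmap, Filter.mem_map]
        filter_upwards [hN, hO.mem_nhds hy] with z hzS hzO
        exact (hmem z hzO).1 (hrange ▸ hzS)
      -- closure argument
      have hclosed : IsClosed (S (i + 1) ∪ S (i + 2)) :=
        ((h.isCompact (i + 1)).isClosed).union ((h.isCompact (i + 2)).isClosed)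
      have hycl : y ∈ S (i + 1) ∪ S (i + 2) := by
        by_contra hyc
        apply hSi
        refine mem_of_superset (hclosed.isOpen_compl.mem_nhds hyc) fun z hz => ?_
        obtain ⟨j, hj⟩ := h.exists_mem z
        have hcases : ∀ i j : Fin 3, j = i ∨ j = i + 1 ∨ j = i + 2 := by decide
        rcases hcases i j with rfl | rfl | rfl
        · exact hj
        · exact absurd (Or.inl hj) hz
        · exact absurd (Or.inr hj) hz
      have hne : ∀ i : Fin 3, i + 1 ≠ i ∧ i + 2 ≠ i := by decide
      rcases hycl with h1 | h2
      · exact ⟨i + 1, (hne i).1, h1⟩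
      · exact ⟨i + 2, (hne i).2, h2⟩
    · obtain ⟨j, hj⟩ := h.exists_mem y
      refine ⟨j, ?_, hj⟩
      rintro rfl
      exact hyi hj

end Trisection

/-! ### The two faces of a sector lie in the two other sectors -/

section InteriorDense

/-- **Interior points are dense in a manifold with boundary**: every point of a `C^n` manifold
(`n ≠ 0`) modelled on the half-space `EuclideanHalfSpace m` lies in the closure of the interior
(push the chart value off the boundary hyperplane `{x₀ = 0}` along `e₀`). [folklore] -/
theorem mem_closure_interior_halfSpace {m : ℕ} [NeZero m] {n : WithTop ℕ∞} (hn : n ≠ 0)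
    {M : Type*} [TopologicalSpace M] [ChartedSpace (EuclideanHalfSpace m) M]
    [IsManifold (𝓡∂ m) n M] (b : M) :
    b ∈ closure ((𝓡∂ m).interior M) := by
  set φ := chartAt (EuclideanHalfSpace m) b with hφdef
  set p : EuclideanSpace ℝ (Fin m) := φ.extend (𝓡∂ m) b with hpdef
  have hb : b ∈ φ.source := mem_chart_source _ b
  have hp0 : 0 ≤ p 0 := by
    have : p ∈ range (𝓡∂ m) := by
      rw [hpdef, OpenPartialHomeomorph.extend_coe]
      exact mem_range_self _
    rwa [range_modelWithCornersEuclideanHalfSpace] at this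
  -- the curve `γ t = p + t e₀` enters the open half-space for `t > 0`
  let γ : ℝ → EuclideanSpace ℝ (Fin m) := fun t => p + t • EuclideanSpace.single (0 : Fin m) (1:ℝ)
  have hγc : Continuous γ := by fun_prop
  have hγ0 : γ 0 = p := by simp [γ]
  have hγt : Tendsto γ (𝓝[>] 0) (𝓝 p) := by
    rw [← hγ0]; exact (hγc.tendsto 0).mono_left nhdsWithin_le_nhds
  have hγpos : ∀ t, 0 < t → 0 < γ t 0 := fun t ht => by
    simp [γ]
    linarith
  have hγrange : Tendsto γ (𝓝[>] 0) (𝓝[range (𝓡∂ m)] p) := by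
    rw [tendsto_nhdsWithin_iff]
    refine ⟨hγt, ?_⟩
    filter_upwards [self_mem_nhdsWithin] with t ht
    rw [range_modelWithCornersEuclideanHalfSpace]
    exact (hγpos t ht).le
  have hT : ∀ᶠ t in 𝓝[>] (0:ℝ), γ t ∈ (φ.extend (𝓡∂ m)).target :=
    hγrange (φ.extend_target_mem_nhdsWithin (I := 𝓡∂ m) hb)
  -- the corresponding points of `M` are interior points converging to `b`
  have hconv : Tendsto (fun t => (φ.extend (𝓡∂ m)).symm (γ t)) (𝓝[>] 0) (𝓝 b) := by
    have hc : ContinuousAt (φ.extend (𝓡∂ m)).symm p := φ.continuousAt_extend_symm hb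
    have hb' : (φ.extend (𝓡∂ m)).symm p = b :=
      (φ.extend (𝓡∂ m)).left_inv (by rwa [OpenPartialHomeomorph.extend_source])
    rw [← hb']
    exact hc.tendsto.comp hγt
  refine mem_closure_of_tendsto hconv ?_
  filter_upwards [hT, self_mem_nhdsWithin] with t htT ht
  have hsrc : (φ.extend (𝓡∂ m)).symm (γ t) ∈ φ.source := by
    have := (φ.extend (𝓡∂ m)).map_target htT
    rwa [OpenPartialHomeomorph.extend_source] at this
  show (𝓡∂ m).IsInteriorPoint ((φ.extend (𝓡∂ m)).symm (γ t))
  rw [(𝓡∂ m).isInteriorPoint_iff_of_mem_atlas hn (chart_mem_atlas _ b) hsrc,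
    (φ.extend (𝓡∂ m)).right_inv htT]
  -- `γ t` lies in the open set `(𝓡∂ m)⁻¹(φ.target) ∩ {x₀ > 0} ⊆ target`
  have hV : IsOpen ((𝓡∂ m).symm ⁻¹' φ.target ∩ {x : EuclideanSpace ℝ (Fin m) | 0 < x 0}) :=
    (φ.open_target.preimage (𝓡∂ m).continuous_symm).inter
      (isOpen_lt continuous_const (EuclideanSpace.proj (0 : Fin m)).continuous)
  refine interior_maximal (fun z hz => ?_) hV ⟨?_, hγpos t ht⟩
  · rw [OpenPartialHomeomorph.extend_target, range_modelWithCornersEuclideanHalfSpace]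
    refine ⟨hz.1, ?_⟩
    show 0 ≤ z 0
    exact le_of_lt hz.2
  · have := htT
    rw [OpenPartialHomeomorph.extend_target] at this
    exact this.1

end InteriorDense

section Faces

variable {X : Type u} [TopologicalSpace X] [ChartedSpace (EuclideanSpace ℝ (Fin 4)) X]
  {g : ℕ} {k : Fin 3 → ℕ} {S : Fin 3 → Set X}

/-- Near a point of the central surface, a double intersection `S i ∩ S l` (`i ≠ l`) is **not**
contained in the central surface: `S i ∩ S l` is an embedded `3`-manifold with boundary `F`
(clause (iii)), whose interior points accumulate at every boundary point.
[cite: GayKirby2016, Def. 1] -/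
theorem IsGKTrisection.not_inter_inter_subset_iInter (h : IsGKTrisection X g k S) {i l : Fin 3}
    (hil : i ≠ l) {x : X} (hx : x ∈ ⋂ j, S j) {N : Set X} (hN : N ∈ 𝓝 x) :
    ¬ (S i ∩ S l ∩ N ⊆ ⋂ j, S j) := by
  intro hsub
  obtain ⟨H, _, _, hh, hM, -, -, -, hemb, hrangeH, hbdH⟩ := h.2.2 i l hil
  have hxF : x ∈ hh '' (𝓡∂ 3).boundary H := hbdH ▸ hx
  obtain ⟨b, hb, rfl⟩ := hxF
  have hcl : b ∈ closure ((𝓡∂ 3).interior H) :=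
    mem_closure_interior_halfSpace (n := ∞) (by simp) b
  have hNb : hh ⁻¹' N ∈ 𝓝 b := hemb.isEmbedding.continuous.continuousAt hN
  obtain ⟨b', hb'N, hb'int⟩ := mem_closure_iff_nhds.mp hcl _ hNb
  have hmem : hh b' ∈ ⋂ j, S j := hsub ⟨hrangeH ▸ mem_range_self b', hb'N⟩
  rw [← hbdH] at hmem
  obtain ⟨b'', hb'', heq⟩ := hmem
  have : b'' = b' := hemb.isEmbedding.injective heq
  subst this
  exact (ModelWithCorners.disjoint_interior_boundary (I := 𝓡∂ 3) (M := H)).le_bot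
    ⟨hb'int, hb''⟩

/-- **The two faces of a sector near the central surface lie in the two other sectors, one in
each (Gay–Kirby's Fig. 1).**  Refinement of `IsGKTrisection.exists_linearChart`: the open
neighbourhood `O` of `x ∈ F` can be chosen so that, writing `q = A⁻¹(ψ y)` for `y ∈ O`, the open
face `{q₀ = 0 < q₁}` of the sector `S i = {q ∈ Q}` lies in `S j₀` and the open face
`{q₁ = 0 < q₀}` in `S j₁`, where `{i, j₀, j₁} = {0, 1, 2}`.  (Each open face is connected on a
round chart ball and is covered by the two other closed sectors, which meet it disjointly — a
common point would be on `F`, the stratum; and both faces cannot lie in the same sector `S j`,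
for then `S i ∩ S l` would be contained in `F` near `x`, contradicting
`IsGKTrisection.not_inter_inter_subset_iInter`.) [cite: GayKirby2016, Def. 1 and Fig. 1] -/
theorem IsGKTrisection.exists_linearChart_faces [T2Space X] (h : IsGKTrisection X g k S)
    (i : Fin 3) {x : X} (hx : x ∈ ⋂ l, S l) :
    ∃ (ψ : OpenPartialHomeomorph X (EuclideanSpace ℝ (Fin 4)))
      (A : (EuclideanSpace ℝ (Fin 4)) ≃L[ℝ] (EuclideanSpace ℝ (Fin 4))) (O : Set X) (j₀ j₁ : Fin 3),
      ψ ∈ IsManifold.maximalAtlas (𝓡 4) ∞ X ∧ IsOpen O ∧ x ∈ O ∧ O ⊆ ψ.source ∧ ψ x = 0 ∧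
      (∀ y ∈ O, y ∈ S i ↔ A.symm (ψ y) ∈ cornerQuadrant) ∧
      (∀ y ∈ O, y ∈ (⋂ l, S l) ↔
        A.symm (ψ y) ∈ cornerQuadrant ∧ A.symm (ψ y) 0 = 0 ∧ A.symm (ψ y) 1 = 0) ∧
      (∀ y ∈ O, (∃ j, j ≠ i ∧ y ∈ S j) ↔ ¬ (0 < A.symm (ψ y) 0 ∧ 0 < A.symm (ψ y) 1)) ∧
      j₀ ≠ i ∧ j₁ ≠ i ∧ j₀ ≠ j₁ ∧
      (∀ y ∈ O, A.symm (ψ y) 0 = 0 → 0 < A.symm (ψ y) 1 → y ∈ S j₀) ∧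
      (∀ y ∈ O, A.symm (ψ y) 1 = 0 → 0 < A.symm (ψ y) 0 → y ∈ S j₁) := by
  obtain ⟨ψ, A, O, hψ, hO, hxO, hOψ, hψ0, hsec, hstr, hoth⟩ := h.exists_linearChart i hx
  -- the coordinate map `c = A⁻¹ ∘ ψ` and a round ball inside `c(O)`
  set c : X → (EuclideanSpace ℝ (Fin 4)) := fun y => A.symm (ψ y) with hcdef
  have hcx : c x = 0 := by simp [hcdef, hψ0]
  have hcO : IsOpen (c '' O) := by
    have : c '' O = A.symm '' (ψ '' O) := by rw [hcdef, ← image_comp]; rfl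
    rw [this]
    exact A.symm.toHomeomorph.isOpenMap _ (ψ.isOpen_image_of_subset_source hO hOψ)
  obtain ⟨r, hr, hball⟩ := Metric.isOpen_iff.mp hcO 0 (hcx ▸ mem_image_of_mem c hxO)
  have hc : ContinuousOn c O := (A.symm.continuous.comp_continuousOn ψ.continuousOn).mono hOψ
  -- the shrunken neighbourhood
  set O' : Set X := O ∩ c ⁻¹' Metric.ball 0 r with hO'def
  have hO' : IsOpen O' := hc.isOpen_inter_preimage hO Metric.isOpen_ball
  have hxO' : x ∈ O' := ⟨hxO, by simp [hcx, hr]⟩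
  have hO'O : O' ⊆ O := inter_subset_left
  -- the inverse coordinate map on the ball
  have hinv : ∀ q ∈ Metric.ball (0 : (EuclideanSpace ℝ (Fin 4))) r,
      ψ.symm (A q) ∈ O' ∧ c (ψ.symm (A q)) = q := by
    intro q hq
    obtain ⟨y, hy, hyq⟩ := hball hq
    have hyq' : ψ.symm (A q) = y := by
      rw [← hyq, hcdef]
      simp only [ContinuousLinearEquiv.apply_symm_apply]
      exact ψ.left_inv (hOψ hy)
    rw [hyq']
    exact ⟨⟨hy, by simpa [hyq] using hq⟩, hyq⟩
  have hcont_inv :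
      ContinuousOn (fun q => ψ.symm (A q)) (Metric.ball (0 : (EuclideanSpace ℝ (Fin 4))) r) := by
    refine ψ.continuousOn_symm.comp A.continuous.continuousOn fun q hq => ?_
    obtain ⟨y, hy, hyq⟩ := hball hq
    rw [← hyq, hcdef]
    simp only [ContinuousLinearEquiv.apply_symm_apply]
    exact ψ.map_source (hOψ hy)
  -- an open face piece over the ball is the image of a convex set, hence preconnected
  have hface_conn : ∀ P : Set (EuclideanSpace ℝ (Fin 4)), Convex ℝ P →
      IsPreconnected {y ∈ O' | c y ∈ P} := by
    intro P hP
    have himg : {y ∈ O' | c y ∈ P} = (fun q => ψ.symm (A q)) '' (Metric.ball 0 r ∩ P) := by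
      ext y
      constructor
      · rintro ⟨hyO', hyP⟩
        refine ⟨c y, ⟨hyO'.2, hyP⟩, ?_⟩
        simp only [hcdef, ContinuousLinearEquiv.apply_symm_apply]
        exact ψ.left_inv (hOψ hyO'.1)
      · rintro ⟨q, ⟨hq, hqP⟩, rfl⟩
        exact ⟨(hinv q hq).1, (hinv q hq).2.symm ▸ hqP⟩
    rw [himg]
    exact (((convex_ball (0 : (EuclideanSpace ℝ (Fin 4))) r).inter hP).isPreconnected).image _
      (hcont_inv.mono inter_subset_left)
  -- each open face piece lies in one of the two other sectors
  have hface : ∀ P : Set (EuclideanSpace ℝ (Fin 4)), Convex ℝ P → P ⊆ cornerQuadrant →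
      (∀ q ∈ P, ¬ (0 < q 0 ∧ 0 < q 1)) → (∀ q ∈ P, ¬ (q 0 = 0 ∧ q 1 = 0)) →
      {y ∈ O' | c y ∈ P} ⊆ S (i + 1) ∨ {y ∈ O' | c y ∈ P} ⊆ S (i + 2) := by
    intro P hP hPQ hPopen hPstr
    refine (isPreconnected_iff_subset_of_disjoint_closed.mp (hface_conn P hP)) _ _
      (h.isCompact (i + 1)).isClosed (h.isCompact (i + 2)).isClosed ?_ ?_
    · rintro y ⟨hyO', hyP⟩
      obtain ⟨j, hji, hyj⟩ := (hoth y (hO'O hyO')).2 (hPopen _ hyP)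
      have hcases : ∀ i j : Fin 3, j = i ∨ j = i + 1 ∨ j = i + 2 := by decide
      rcases hcases i j with rfl | rfl | rfl
      · exact absurd rfl hji
      · exact Or.inl hyj
      · exact Or.inr hyj
    · rw [eq_empty_iff_forall_notMem]
      rintro y ⟨⟨hyO', hyP⟩, hy1, hy2⟩
      have hyi : y ∈ S i := (hsec y (hO'O hyO')).2 (hPQ hyP)
      have hyF : y ∈ ⋂ l, S l := by
        simp only [mem_iInter]
        intro l
        have hcases : ∀ i j : Fin 3, j = i ∨ j = i + 1 ∨ j = i + 2 := by decide
        rcases hcases i l with rfl | rfl | rfl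
        exacts [hyi, hy1, hy2]
      obtain ⟨-, h0, h1⟩ := (hstr y (hO'O hyO')).1 hyF
      exact hPstr _ hyP ⟨h0, h1⟩
  -- the two faces
  let P₀ : Set (EuclideanSpace ℝ (Fin 4)) := {q | q 0 = 0 ∧ 0 < q 1}
  let P₁ : Set (EuclideanSpace ℝ (Fin 4)) := {q | q 1 = 0 ∧ 0 < q 0}
  have hlin0 : IsLinearMap ℝ fun q : (EuclideanSpace ℝ (Fin 4)) => q 0 :=
    (EuclideanSpace.proj (0 : Fin 4)).isLinear
  have hlin1 : IsLinearMap ℝ fun q : (EuclideanSpace ℝ (Fin 4)) => q 1 :=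
    (EuclideanSpace.proj (1 : Fin 4)).isLinear
  have hP₀c : Convex ℝ P₀ := (convex_hyperplane hlin0 0).inter (convex_halfSpace_gt hlin1 0)
  have hP₁c : Convex ℝ P₁ := (convex_hyperplane hlin1 0).inter (convex_halfSpace_gt hlin0 0)
  obtain ⟨j₀, hj₀, hj₀S⟩ : ∃ j₀, (j₀ = i + 1 ∨ j₀ = i + 2) ∧ {y ∈ O' | c y ∈ P₀} ⊆ S j₀ := by
    rcases hface P₀ hP₀c (fun q hq => ⟨hq.1.ge, hq.2.le⟩) (fun q hq hh => by
      have h1 : q 0 = 0 := hq.1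
      have h2 : 0 < q 0 := hh.1
      rw [h1] at h2; exact lt_irrefl _ h2) (fun q hq hh => by
      have h1 : 0 < q 1 := hq.2
      have h2 : q 1 = 0 := hh.2
      rw [h2] at h1; exact lt_irrefl _ h1) with h0 | h0
    · exact ⟨i + 1, Or.inl rfl, h0⟩
    · exact ⟨i + 2, Or.inr rfl, h0⟩
  obtain ⟨j₁, hj₁, hj₁S⟩ : ∃ j₁, (j₁ = i + 1 ∨ j₁ = i + 2) ∧ {y ∈ O' | c y ∈ P₁} ⊆ S j₁ := by
    rcases hface P₁ hP₁c (fun q hq => ⟨hq.2.le, hq.1.ge⟩) (fun q hq hh => by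
      have h1 : q 1 = 0 := hq.1
      have h2 : 0 < q 1 := hh.2
      rw [h1] at h2; exact lt_irrefl _ h2) (fun q hq hh => by
      have h1 : 0 < q 0 := hq.2
      have h2 : q 0 = 0 := hh.1
      rw [h2] at h1; exact lt_irrefl _ h1) with h0 | h0
    · exact ⟨i + 1, Or.inl rfl, h0⟩
    · exact ⟨i + 2, Or.inr rfl, h0⟩
  have hne : ∀ i : Fin 3, i + 1 ≠ i ∧ i + 2 ≠ i ∧ i + 1 ≠ i + 2 := by decide
  have hj₀i : j₀ ≠ i := by rcases hj₀ with rfl | rfl; exacts [(hne i).1, (hne i).2.1]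
  have hj₁i : j₁ ≠ i := by rcases hj₁ with rfl | rfl; exacts [(hne i).1, (hne i).2.1]
  -- the two faces go to different sectors
  have hdiff : j₀ ≠ j₁ := by
    intro hjj
    -- the third sector `S l`
    obtain ⟨l, hli, hlj, hcov⟩ : ∃ l, l ≠ i ∧ l ≠ j₀ ∧ ∀ j, j ≠ i → j = j₀ ∨ j = l := by
      rcases hj₀ with rfl | rfl
      · refine ⟨i + 2, (hne i).2.1, (hne i).2.2.symm, fun j hj => ?_⟩
        have hcases : ∀ i j : Fin 3, j = i ∨ j = i + 1 ∨ j = i + 2 := by decide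
        rcases hcases i j with rfl | rfl | rfl
        exacts [absurd rfl hj, Or.inl rfl, Or.inr rfl]
      · refine ⟨i + 1, (hne i).1, (hne i).2.2, fun j hj => ?_⟩
        have hcases : ∀ i j : Fin 3, j = i ∨ j = i + 1 ∨ j = i + 2 := by decide
        rcases hcases i j with rfl | rfl | rfl
        exacts [absurd rfl hj, Or.inr rfl, Or.inl rfl]
    -- `S i ∩ S l ∩ O' ⊆ F`
    apply h.not_inter_inter_subset_iInter hli.symm hx (hO'.mem_nhds hxO')
    rintro y ⟨⟨hyi, hyl⟩, hyO'⟩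
    have hQ : c y ∈ cornerQuadrant := (hsec y (hO'O hyO')).1 hyi
    have hnot : ¬ (0 < c y 0 ∧ 0 < c y 1) := (hoth y (hO'O hyO')).1 ⟨l, hli, hyl⟩
    -- `y` is on a face or on the stratum; on a face it lies in `S j₀` too, hence in all three
    have hyall : y ∈ S j₀ → y ∈ ⋂ j, S j := fun hyj₀ => by
      simp only [mem_iInter]
      intro j
      by_cases hj : j = i
      · exact hj ▸ hyi
      · rcases hcov j hj with rfl | rfl
        exacts [hyj₀, hyl]
    rcases hQ.1.lt_or_eq with h0 | h0
    · rcases hQ.2.lt_or_eq with h1 | h1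
      · exact absurd ⟨h0, h1⟩ hnot
      · exact hyall (hjj ▸ hj₁S ⟨hyO', h1.symm, h0⟩)
    · rcases hQ.2.lt_or_eq with h1 | h1
      · exact hyall (hj₀S ⟨hyO', h0.symm, h1⟩)
      · exact (hstr y (hO'O hyO')).2 ⟨hQ, h0.symm, h1.symm⟩
  refine ⟨ψ, A, O', j₀, j₁, hψ, hO', hxO', hO'O.trans hOψ, hψ0,
    fun y hy => hsec y (hO'O hy), fun y hy => hstr y (hO'O hy), fun y hy => hoth y (hO'O hy),
    hj₀i, hj₁i, hdiff, fun y hy h0 h1 => hj₀S ⟨hy, h0, h1⟩, fun y hy h1 h0 => hj₁S ⟨hy, h1, h0⟩⟩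

end Faces





end Literature.Topology.FourManifolds
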